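import Literature.MathematicalPhysics.KineticTheory.HardSphereMarginalTrace
import Literature.Analysis.FluidPDE.HardSphereCollisionRecord
import HarnessLib

/-!
# The pathwise cluster virial bound: momentum-transfer-weighted collision counts of an
# autonomous hard-sphere cluster are bounded polynomially in the cluster size

Brick `stub_eqMomentClusterVirial` (registered sub-goal) toward the stub `stub_eqMoment` of the line
`Sketch` of the crux `ContactAngleEquidistribution` (stmt-AtomisticToContinuum-12097, route
LambertianContactSwap), companion of `…EqMomentClusterAutonomy` (energy-separated clusters are
autonomous during a short window).  For a good orbit of a hard-sphere flow on `𝕋^d`, a window `[a, b]`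
and a set of particles `S` that interacts only with itself during `(a, b]`, stays within minimal-image
distance `1/4` of a base point `c` and has speeds `≤ u`, `u (b - a) ≤ 1/4`, we PROVE Clausius' virial
computation pathwise in the chart about `c` (where the minimal image is additive,
`reprSym_sub_eq_sub_of_lt`, `reprSym_translate_sub_eq`): the CLUSTER VIRIAL
`G_S(t) = Σ_{k ∈ S} ⟪reprSym (x_k(t) - c), v_k(t)⟫` grows by `(t - s) Σ_{k ∈ S} ‖v_k‖² ≥ 0` along free
stretches (`clusterVirial_freeFlight`) and jumps by exactly the post-collisional normal relative
velocity `⟪x_p - x_q, v_p⁺ - v_q⁺⟫ > 0` at a collision inside `S` (`clusterVirial_collidePair_of_mem`;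
a collision outside `S` does not affect it).  Hence, by orbit induction (`flow_window_induction`),

  `Σ_{collision times s ∈ (a, b]} Σ_{i ≠ j ∈ S in contact} ⟪x_i - x_j, v_i⁺ - v_j⁺⟫ ≤ 2 (G_S(b) - G_S(a))`

(`stub_eqMomentClusterVirial`), and `|G_S| ≤ (1/4) Σ_{k ∈ S} ‖v_k‖ ≤ |S| u / 4` (`abs_clusterVirial_le`):
the momentum-transfer-weighted collision count `Σ |⟪n̂, g⟫| = ε⁻¹ Σ ⟪n, g⁺⟫` of the cluster over the
window is at most `|S| u / (2ε)` — POLYNOMIAL in `|S|`, whereas the only uniform bound on the NUMBER of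
collisions of `|S|` hard balls is superexponential (Burago–Ferleger–Kononenko 1998).  Every summand is
positive (`IsHardSphereTrajectory.isOutgoing_of_mem_contactSet`).

References: R. Clausius, Phil. Mag. 40 (1870) 122–127 (the virial); I. Gallagher, L. Saint-Raymond,
B. Texier, *From Newton to Boltzmann*, EMS (2013), §4.1 [GST2013]; D. Burago, S. Ferleger,
A. Kononenko, Ann. of Math. 147 (1998) 695–708 (context only, nothing of it is used).
-/

noncomputable section

open MeasureTheory Filter Set Topology Function
open scoped ENNReal InnerProductSpace BigOperators Classical

namespace Summit.AtomisticToContinuum.HydrodynamicLimit.Theorems.ContactAngleEquidistributionSketch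

open Literature.Analysis.FluidPDE Literature.MathematicalPhysics.KineticTheory

variable {d : Type*} [Fintype d] {N : ℕ} {ε : ℝ}

/-! ## Orbit induction along a good orbit, with the free-flight and collision formulas -/

section Orbit

/-- **Induction along a good orbit of a hard-sphere flow on the torus over a window `[a, b]`** (flow
form of `window_induction` of `…EqMomentClusterAutonomy`, with the dynamics handed over): `Q` holds on
`[a, b]` if it holds at `a`, propagates along collision-free stretches `(s, t]` — where
`Φ_t z = S_{t-s} (Φ_s z)` — and across a collision time `t` after a collision-free `(s, t)` — where
`Φ_t z = collidePair p q (S_{t-s} (Φ_s z))` for a contact pair `(p, q)` (`leftLim_eq_freeFlight`,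
`eq_collidePair_leftLim`).  Strong induction on the number of collision times in `(a, t]`. [folklore] -/
theorem flow_window_induction (Φ : HardSphereFlow (Torus.geometry d) ε N)
    {z : Config N d (UnitAddTorus d)} (hz : z ∈ Φ.good) {a b : ℝ} (Q : ℝ → Prop) (ha : Q a)
    (hfree : ∀ s t, a ≤ s → s ≤ t → t ≤ b → Q s →
      (∀ σ ∈ Ioc s t, σ ∉ collisionTimes (Torus.geometry d) ε (fun t => Φ.flow t z)) →
      Φ.flow t z = freeFlight (Torus.geometry d) (t - s) (Φ.flow s z) → Q t)
    (hjump : ∀ s t, a ≤ s → s < t → t ≤ b → Q s →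
      (∀ σ ∈ Ioo s t, σ ∉ collisionTimes (Torus.geometry d) ε (fun t => Φ.flow t z)) →
      t ∈ collisionTimes (Torus.geometry d) ε (fun t => Φ.flow t z) →
      ∀ p q : Fin N, p ≠ q → Φ.flow t z ∈ contactSet (Torus.geometry d) N ε p q →
      Φ.flow t z = collidePair (Torus.geometry d) p q (freeFlight (Torus.geometry d) (t - s) (Φ.flow s z)) →
      Q t) :
    ∀ t ∈ Icc a b, Q t := by
  -- proof adapted from `window_induction` (…EqMomentClusterAutonomy)
  have hγ := Φ.isTrajectory z hz
  have hG : ∀ x : UnitAddTorus d, Continuous ((Torus.geometry d).translate x) :=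
    Torus.continuous_geometry_translate
  -- the two propagation steps in the form of `window_induction`
  have hfree' : ∀ s t, a ≤ s → s ≤ t → t ≤ b → Q s →
      (∀ σ ∈ Ioc s t, σ ∉ collisionTimes (Torus.geometry d) ε (fun t => Φ.flow t z)) → Q t :=
    fun s t has hst htb hQ hfr => hfree s t has hst htb hQ hfr (hγ.free s t hst hfr)
  have hjump' : ∀ s t, a ≤ s → s < t → t ≤ b → Q s →
      (∀ σ ∈ Ioo s t, σ ∉ collisionTimes (Torus.geometry d) ε (fun t => Φ.flow t z)) →
      t ∈ collisionTimes (Torus.geometry d) ε (fun t => Φ.flow t z) → Q t := by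
    intro s t has hst htb hQ hfr htc
    obtain ⟨p, q, hpq, hc⟩ := mem_collisionTimes.1 htc
    obtain ⟨-, heq⟩ := hγ.eq_collidePair_leftLim hpq hc
    rw [hγ.leftLim_eq_freeFlight hG hst hfr] at heq
    exact hjump s t has hst htb hQ hfr htc p q hpq hc heq
  -- induction on the finite set of collision times of `(a, b]`, through its maximum
  have hfin : (collisionTimes (Torus.geometry d) ε (fun t => Φ.flow t z) ∩ Ioc a b).Finite :=
    (hγ.locFinite a b).subset (inter_subset_inter_right _ Ioc_subset_Icc_self)
  suffices H : ∀ F : Finset ℝ, ∀ t ∈ Icc a b,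
      (∀ σ ∈ collisionTimes (Torus.geometry d) ε (fun t => Φ.flow t z) ∩ Ioc a t, σ ∈ F) → Q t from
    fun t ht => H hfin.toFinset t ht fun σ hσ => hfin.mem_toFinset.2 ⟨hσ.1, hσ.2.1, hσ.2.2.trans ht.2⟩
  intro F
  induction F using Finset.induction_on_max with
  | empty => exact fun t ht hF => hfree' a t le_rfl ht.1 ht.2 ha fun σ hσ hσc =>
      Finset.notMem_empty σ (hF σ ⟨hσc, hσ⟩)
  | insert m F hFm ih =>
    intro t ht hF
    by_cases hm : m ∈ collisionTimes (Torus.geometry d) ε (fun t => Φ.flow t z) ∧ a < m ∧ m ≤ t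
    · obtain ⟨hmc, ham, hmt⟩ := hm
      -- `s₀`: the last element of `F` in `[a, m)`, or `a`; `(s₀, m)` is collision-free
      set F₀ : Finset ℝ := insert a (F.filter fun x => a ≤ x) with hF₀
      have hne : F₀.Nonempty := ⟨a, Finset.mem_insert_self _ _⟩
      have has₀ : a ≤ F₀.max' hne := F₀.le_max' a (Finset.mem_insert_self _ _)
      have hs₀m : F₀.max' hne < m := (F₀.max'_lt_iff hne).2 fun x hx => by
        rcases Finset.mem_insert.1 hx with rfl | hx
        · exact ham
        · exact hFm x (Finset.mem_filter.1 hx).1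
      have hmemF : ∀ σ, σ ∈ collisionTimes (Torus.geometry d) ε (fun t => Φ.flow t z) → a < σ →
          σ ≤ t → σ ≠ m → σ ∈ F := fun σ hσc hσa hσt hσm =>
        (Finset.mem_insert.1 (hF σ ⟨hσc, hσa, hσt⟩)).resolve_left hσm
      have hQ₀ : Q (F₀.max' hne) :=
        ih _ ⟨has₀, hs₀m.le.trans (hmt.trans ht.2)⟩ fun σ hσ =>
          hmemF σ hσ.1 hσ.2.1 (hσ.2.2.trans (hs₀m.le.trans hmt)) (ne_of_lt (hσ.2.2.trans_lt hs₀m))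
      have hQm : Q m := hjump' _ m has₀ hs₀m (hmt.trans ht.2) hQ₀ (fun σ hσ hσc =>
        (not_lt.2 (F₀.le_max' σ (Finset.mem_insert_of_mem (Finset.mem_filter.2
          ⟨hmemF σ hσc (has₀.trans_lt hσ.1) (hσ.2.le.trans hmt) (ne_of_lt hσ.2), has₀.trans hσ.1.le⟩))))
          hσ.1) hmc
      exact hfree' m t ham.le hmt ht.2 hQm fun σ hσ hσc =>
        (not_lt.2 (hFm σ (hmemF σ hσc (ham.trans hσ.1) hσ.2 (ne_of_gt hσ.1))).le) hσ.1
    · exact ih t ht fun σ hσ => (Finset.mem_insert.1 (hF σ hσ)).resolve_left fun hσm =>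
        hm ⟨hσm ▸ hσ.1, hσm ▸ hσ.2.1, hσm ▸ hσ.2.2⟩

end Orbit

/-! ## The chart about a base point and the cluster virial -/

section Chart

/-- **Additivity of the minimal image on small triangles** (any dimension; the case `d = 3` is
`reprSym_sub_eq_sub` of `HardSphereCanonicalKSLimit`): if `x, x'` are within minimal-image distance
`1/4` of `c`, then `reprSym (x - x') = reprSym (x - c) - reprSym (x' - c)`. [folklore] -/
theorem reprSym_sub_eq_sub_of_lt {x x' c : UnitAddTorus d} (hx : Torus.euclidDist x c < 1 / 4)
    (hx' : Torus.euclidDist x' c < 1 / 4) :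
    Torus.reprSym (x - x') = Torus.reprSym (x - c) - Torus.reprSym (x' - c) := by
  -- adapted from `reprSym_sub_eq_sub` (HardSphereCanonicalKSLimit)
  rw [Torus.euclidDist_eq] at hx hx'
  have hdecomp : x - x' =
      (x - c) + Literature.Analysis.FunctionSpaces.Torus.proj (-Torus.reprSym (x' - c)) := by
    rw [Literature.Analysis.FunctionSpaces.Torus.proj_neg, Torus.proj_reprSym]; abel
  rw [hdecomp, Torus.reprSym_add_proj_of_norm_lt (by rw [norm_neg]; linarith)]
  abel

/-- **Free flight in the chart**: translating `x` by `proj w` translates its lift about `c` by `w`,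
as long as `‖reprSym (x - c)‖ + ‖w‖ < 1/2`. [folklore] -/
theorem reprSym_translate_sub_eq {x c : UnitAddTorus d} {w : EuclideanSpace ℝ d}
    (h : ‖Torus.reprSym (x - c)‖ + ‖w‖ < 1 / 2) :
    Torus.reprSym (x + Literature.Analysis.FunctionSpaces.Torus.proj w - c) =
      Torus.reprSym (x - c) + w := by
  rw [show x + Literature.Analysis.FunctionSpaces.Torus.proj w - c =
      (x - c) + Literature.Analysis.FunctionSpaces.Torus.proj w by abel,
    Torus.reprSym_add_proj_of_norm_lt h]

/-- **The cluster virial grows along free flight**: for a set of particles `S` whose lifts about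
`c` stay in the chart during the flight (`‖x̃_k‖ + ‖τ v_k‖ < 1/2`),
`Σ_{k ∈ S} ⟪x̃_k(τ), v_k⟫ = Σ_{k ∈ S} ⟪x̃_k, v_k⟫ + τ Σ_{k ∈ S} ‖v_k‖²`. [folklore] -/
theorem clusterVirial_freeFlight (S : Finset (Fin N)) (c : UnitAddTorus d)
    (w : Config N d (UnitAddTorus d)) (τ : ℝ)
    (hch : ∀ k ∈ S, ‖Torus.reprSym ((w k).1 - c)‖ + ‖τ • (w k).2‖ < 1 / 2) :
    (∑ k ∈ S, ⟪Torus.reprSym ((freeFlight (Torus.geometry d) τ w k).1 - c),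
        (freeFlight (Torus.geometry d) τ w k).2⟫_ℝ) =
      (∑ k ∈ S, ⟪Torus.reprSym ((w k).1 - c), (w k).2⟫_ℝ) + τ * ∑ k ∈ S, ‖(w k).2‖ ^ 2 := by
  rw [Finset.mul_sum, ← Finset.sum_add_distrib]
  refine Finset.sum_congr rfl fun k hk => ?_
  rw [freeFlight_apply, Torus.geometry_translate, reprSym_translate_sub_eq (hch k hk),
    inner_add_left, real_inner_smul_left, real_inner_self_eq_norm_sq]

/-- **The jump of the cluster virial at an intra-cluster collision in the chart** is the
post-collisional normal relative velocity: for `p ≠ q` both in `S` and both within `1/4` of `c`,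
`Σ_{k ∈ S} ⟪x̃_k, v_k'⟫ = Σ_{k ∈ S} ⟪x̃_k, v_k⟫ + ⟪x_p - x_q, v_p' - v_q'⟫` (the positions do not move,
`v_p' - v_p = -(v_q' - v_q)` is along `n = x_p - x_q = x̃_p - x̃_q`). [folklore] -/
theorem clusterVirial_collidePair_of_mem (S : Finset (Fin N)) (c : UnitAddTorus d)
    (w : Config N d (UnitAddTorus d)) {p q : Fin N} (hpq : p ≠ q) (hp : p ∈ S) (hq : q ∈ S)
    (hcp : Torus.euclidDist (w p).1 c < 1 / 4) (hcq : Torus.euclidDist (w q).1 c < 1 / 4) :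
    (∑ k ∈ S, ⟪Torus.reprSym ((collidePair (Torus.geometry d) p q w k).1 - c),
        (collidePair (Torus.geometry d) p q w k).2⟫_ℝ) =
      (∑ k ∈ S, ⟪Torus.reprSym ((w k).1 - c), (w k).2⟫_ℝ) +
        ⟪(Torus.geometry d).sepVec (w p).1 (w q).1,
          (collidePair (Torus.geometry d) p q w p).2 - (collidePair (Torus.geometry d) p q w q).2⟫_ℝ := by
  set n : EuclideanSpace ℝ d := (Torus.geometry d).sepVec (w p).1 (w q).1 with hn
  set α : ℝ := ⟪(w p).2 - (w q).2, n⟫_ℝ / ‖n‖ ^ 2 with hα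
  have hvp : (collidePair (Torus.geometry d) p q w p).2 = (w p).2 - α • n := by
    rw [collidePair_apply_left hpq]; rfl
  have hvq : (collidePair (Torus.geometry d) p q w q).2 = (w q).2 + α • n := by
    rw [collidePair_apply_right]; rfl
  -- the lifts: `x̃_p - x̃_q = n`
  have hlift : Torus.reprSym ((w p).1 - c) - Torus.reprSym ((w q).1 - c) = n := by
    rw [hn, Torus.geometry_sepVec, reprSym_sub_eq_sub_of_lt hcp hcq]
  -- split off the two colliders from the sum
  rw [← sub_eq_iff_eq_add', ← Finset.sum_sub_distrib]
  rw [Finset.sum_eq_add_of_mem p q hp hq hpq fun k _ hk => by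
    rw [collidePair_apply_of_ne hk.1 hk.2, sub_self]]
  simp only [collidePair_apply_fst]
  rw [hvp, hvq]
  -- both sides equal `-α ‖n‖² = ⟪n, v_p - v_q⟫ - 2 α ‖n‖²`
  have hL : ⟪Torus.reprSym ((w p).1 - c), (w p).2 - α • n⟫_ℝ - ⟪Torus.reprSym ((w p).1 - c), (w p).2⟫_ℝ +
      (⟪Torus.reprSym ((w q).1 - c), (w q).2 + α • n⟫_ℝ - ⟪Torus.reprSym ((w q).1 - c), (w q).2⟫_ℝ) =
      -α * ⟪Torus.reprSym ((w p).1 - c) - Torus.reprSym ((w q).1 - c), n⟫_ℝ := by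
    rw [inner_sub_right, inner_add_right, inner_smul_right, inner_smul_right, inner_sub_left]; ring
  have hR : ⟪n, (w p).2 - α • n - ((w q).2 + α • n)⟫_ℝ =
      ⟪n, (w p).2 - (w q).2⟫_ℝ - 2 * α * ‖n‖ ^ 2 := by
    have : (w p).2 - α • n - ((w q).2 + α • n) = ((w p).2 - (w q).2) - (2 * α) • n := by
      rw [mul_smul, two_smul]; abel
    rw [this, inner_sub_right, inner_smul_right, real_inner_self_eq_norm_sq]
  rw [hL, hR, hlift, real_inner_self_eq_norm_sq]
  by_cases h0 : n = 0
  · simp [h0]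
  · have hn2 : ‖n‖ ^ 2 ≠ 0 := pow_ne_zero 2 (norm_ne_zero_iff.2 h0)
    rw [hα, real_inner_comm n ((w p).2 - (w q).2)]
    field_simp
    ring

/-- A collision of two particles outside `S` does not change the cluster virial of `S`. [folklore] -/
theorem clusterVirial_collidePair_of_not_mem (S : Finset (Fin N)) (c : UnitAddTorus d)
    (w : Config N d (UnitAddTorus d)) {p q : Fin N} (hp : p ∉ S) (hq : q ∉ S) :
    (∑ k ∈ S, ⟪Torus.reprSym ((collidePair (Torus.geometry d) p q w k).1 - c),
        (collidePair (Torus.geometry d) p q w k).2⟫_ℝ) =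
      ∑ k ∈ S, ⟪Torus.reprSym ((w k).1 - c), (w k).2⟫_ℝ := by
  refine Finset.sum_congr rfl fun k hk => ?_
  rw [collidePair_apply_of_ne (fun h : k = p => hp (h ▸ hk)) (fun h : k = q => hq (h ▸ hk))]

/-- In the chart the cluster virial is at most `(1/4) Σ_{k ∈ S} ‖v_k‖` in absolute value. [folklore] -/
theorem abs_clusterVirial_le (S : Finset (Fin N)) (c : UnitAddTorus d)
    (w : Config N d (UnitAddTorus d)) (hch : ∀ k ∈ S, Torus.euclidDist (w k).1 c < 1 / 4) :
    |∑ k ∈ S, ⟪Torus.reprSym ((w k).1 - c), (w k).2⟫_ℝ| ≤ 4⁻¹ * ∑ k ∈ S, ‖(w k).2‖ := by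
  rw [Finset.mul_sum]
  refine (Finset.abs_sum_le_sum_abs _ _).trans (Finset.sum_le_sum fun k hk => ?_)
  refine (abs_real_inner_le_norm _ _).trans ?_
  have h := hch k hk
  rw [Torus.euclidDist_eq] at h
  nlinarith [norm_nonneg (w k).2]

end Chart

/-! ## Pair sums at a binary collision -/

section PairSums

variable {X : Type*}

/-- At a binary collision of `(p, q)` with both colliders in `S`, the ordered pair sum over `S × S`
of a swap-symmetric summand has exactly the two terms `(p, q)` and `(q, p)`. [folklore] -/
theorem sum_sum_ite_eq_two_mul (S : Finset (Fin N)) (G : Geometry d X) (w : Config N d X)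
    {p q : Fin N} (hpq : p ≠ q) (hp : p ∈ S) (hq : q ∈ S) (hnorm : ‖G.sepVec (w p).1 (w q).1‖ = ε)
    (hnorm' : ‖G.sepVec (w q).1 (w p).1‖ = ε)
    (huniq : ∀ e : Fin N × Fin N, e.1 ≠ e.2 → ‖G.sepVec (w e.1).1 (w e.2).1‖ = ε →
      e = (p, q) ∨ e = (q, p))
    (f : Fin N → Fin N → ℝ) (hf : f q p = f p q) :
    (∑ i ∈ S, ∑ j ∈ S, if i ≠ j ∧ ‖G.sepVec (w i).1 (w j).1‖ = ε then f i j else 0) = 2 * f p q := by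
  rw [← Finset.sum_product']
  rw [Finset.sum_eq_add_of_mem (p, q) (q, p) (Finset.mk_mem_product hp hq)
    (Finset.mk_mem_product hq hp) (fun h => hpq (Prod.mk.inj h).1) fun e _ hne =>
    if_neg fun h => (huniq e h.1 h.2).elim hne.1 hne.2]
  rw [if_pos ⟨hpq, hnorm⟩, if_pos ⟨hpq.symm, hnorm'⟩, hf, two_mul]

/-- At a binary collision of two particles outside `S` the ordered pair sum over `S × S` vanishes.
[folklore] -/
theorem sum_sum_ite_eq_zero (S : Finset (Fin N)) (G : Geometry d X) (w : Config N d X)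
    {p q : Fin N} (hp : p ∉ S) (hq : q ∉ S)
    (huniq : ∀ e : Fin N × Fin N, e.1 ≠ e.2 → ‖G.sepVec (w e.1).1 (w e.2).1‖ = ε →
      e = (p, q) ∨ e = (q, p)) (f : Fin N → Fin N → ℝ) :
    (∑ i ∈ S, ∑ j ∈ S, if i ≠ j ∧ ‖G.sepVec (w i).1 (w j).1‖ = ε then f i j else 0) = 0 := by
  refine Finset.sum_eq_zero fun i hi => Finset.sum_eq_zero fun j _ => if_neg fun h => ?_
  rcases huniq (i, j) h.1 h.2 with h | h
  · exact hp ((Prod.mk.inj h).1 ▸ hi)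
  · exact hq ((Prod.mk.inj h).1 ▸ hi)

end PairSums

/-! ## The stub: the pathwise cluster virial bound -/

section Virial

/-- **Pathwise cluster virial bound** (registered sub-goal `stub_eqMomentClusterVirial` of stub
`stub_eqMoment`, line `Sketch`, stmt-AtomisticToContinuum-12097).  If during `[a, b]` the particles of
`S` interact only among themselves (every contact pair at a collision time of `(a, b]` is inside `S`
or disjoint from `S`), stay within minimal-image distance `1/4` of `c`, and have speeds `≤ u` with
`u (b - a) ≤ 1/4`, then the collision sum over `(a, b]` of the post-collisional normal relative
velocities `⟪x_i - x_j, v_i⁺ - v_j⁺⟫ > 0` of the ordered contact pairs inside `S` is at most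
`2 (G_S(b) - G_S(a))`, `G_S = Σ_{k ∈ S} ⟪reprSym (x_k - c), v_k⟫` the cluster virial (orbit induction:
free stretches increase `G_S`, a collision inside `S` makes it jump by `⟪n, g⁺⟫`, half the two
ordered terms it contributes to the sum; a collision outside `S` changes nothing). [folklore] -/
theorem stub_eqMomentClusterVirial {d : Type*} [Fintype d] {N : ℕ} {ε : ℝ}
    (Φ : HardSphereFlow (Torus.geometry d) ε N) {z : Config N d (UnitAddTorus d)} (hz : z ∈ Φ.good)
    (S : Finset (Fin N)) (c : UnitAddTorus d) {a b u : ℝ} (hab : a ≤ b)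
    (haut : ∀ s ∈ collisionTimes (Torus.geometry d) ε (fun t => Φ.flow t z) ∩ Ioc a b, ∀ i j,
      i ≠ j → Φ.flow s z ∈ contactSet (Torus.geometry d) N ε i j → (i ∈ S ↔ j ∈ S))
    (hchart : ∀ t ∈ Icc a b, ∀ k ∈ S, Torus.euclidDist (Φ.flow t z k).1 c < 1 / 4)
    (hu : ∀ t ∈ Icc a b, ∀ k ∈ S, ‖(Φ.flow t z k).2‖ ≤ u) (hub : u * (b - a) ≤ 1 / 4) :
    (∑ᶠ s ∈ collisionTimes (Torus.geometry d) ε (fun t => Φ.flow t z) ∩ Ioc a b,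
      ∑ i ∈ S, ∑ j ∈ S,
        (if i ≠ j ∧ ‖(Torus.geometry d).sepVec (Φ.flow s z i).1 (Φ.flow s z j).1‖ = ε then
          ⟪(Torus.geometry d).sepVec (Φ.flow s z i).1 (Φ.flow s z j).1,
            (Φ.flow s z i).2 - (Φ.flow s z j).2⟫_ℝ else 0)) ≤
    2 * ((∑ k ∈ S, ⟪Torus.reprSym ((Φ.flow b z k).1 - c), (Φ.flow b z k).2⟫_ℝ) -
      ∑ k ∈ S, ⟪Torus.reprSym ((Φ.flow a z k).1 - c), (Φ.flow a z k).2⟫_ℝ) := by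
  have hγ := Φ.isTrajectory z hz
  have hfin : ∀ s t : ℝ, (collisionTimes (Torus.geometry d) ε (fun t => Φ.flow t z) ∩ Ioc s t).Finite :=
    fun s t => (hγ.locFinite s t).subset (inter_subset_inter_right _ Ioc_subset_Icc_self)
  -- the cluster virial does not decrease along a free stretch `[s, t] ⊆ [a, b]`
  have hVfree : ∀ s t, a ≤ s → s ≤ t → t ≤ b →
      (∑ k ∈ S, ⟪Torus.reprSym ((Φ.flow s z k).1 - c), (Φ.flow s z k).2⟫_ℝ) ≤
        ∑ k ∈ S, ⟪Torus.reprSym ((freeFlight (Torus.geometry d) (t - s) (Φ.flow s z) k).1 - c),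
          (freeFlight (Torus.geometry d) (t - s) (Φ.flow s z) k).2⟫_ℝ := by
    intro s t has hst htb
    have hsI : s ∈ Icc a b := ⟨has, hst.trans htb⟩
    rw [clusterVirial_freeFlight S c (Φ.flow s z) (t - s) fun k hk => ?_]
    · have : 0 ≤ (t - s) * ∑ k ∈ S, ‖(Φ.flow s z k).2‖ ^ 2 :=
        mul_nonneg (sub_nonneg.2 hst) (Finset.sum_nonneg fun k _ => by positivity)
      linarith
    · have h1 : ‖Torus.reprSym ((Φ.flow s z k).1 - c)‖ < 1 / 4 := by
        rw [← Torus.euclidDist_eq]; exact hchart s hsI k hk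
      have h2 : (t - s) * ‖(Φ.flow s z k).2‖ ≤ (b - a) * u :=
        mul_le_mul (by linarith) (hu s hsI k hk) (norm_nonneg _) (by linarith)
      rw [norm_smul, Real.norm_of_nonneg (sub_nonneg.2 hst)]
      linarith [mul_comm u (b - a)]
  refine flow_window_induction Φ hz (fun t =>
    (∑ᶠ s ∈ collisionTimes (Torus.geometry d) ε (fun t => Φ.flow t z) ∩ Ioc a t,
      ∑ i ∈ S, ∑ j ∈ S,
        (if i ≠ j ∧ ‖(Torus.geometry d).sepVec (Φ.flow s z i).1 (Φ.flow s z j).1‖ = ε then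
          ⟪(Torus.geometry d).sepVec (Φ.flow s z i).1 (Φ.flow s z j).1,
            (Φ.flow s z i).2 - (Φ.flow s z j).2⟫_ℝ else 0)) ≤
    2 * ((∑ k ∈ S, ⟪Torus.reprSym ((Φ.flow t z k).1 - c), (Φ.flow t z k).2⟫_ℝ) -
      ∑ k ∈ S, ⟪Torus.reprSym ((Φ.flow a z k).1 - c), (Φ.flow a z k).2⟫_ℝ)) ?_ ?_ ?_ b ⟨hab, le_rfl⟩
  · -- base: no collision time in `(a, a]`
    rw [Ioc_self, inter_empty, finsum_mem_empty, sub_self, mul_zero]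
  · -- free stretch `(s, t]`
    intro s t has hst htb hQs hfr hff
    have hset : collisionTimes (Torus.geometry d) ε (fun t => Φ.flow t z) ∩ Ioc a t =
        collisionTimes (Torus.geometry d) ε (fun t => Φ.flow t z) ∩ Ioc a s :=
      Set.ext fun σ => ⟨fun h => ⟨h.1, h.2.1, le_of_not_gt fun hσs => hfr σ ⟨hσs, h.2.2⟩ h.1⟩,
        fun h => ⟨h.1, h.2.1, h.2.2.trans hst⟩⟩
    have hV := hVfree s t has hst htb
    rw [← hff] at hV
    rw [hset]
    linarith
  · -- a collision at `t` after the free stretch `(s, t)`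
    intro s t has hst htb hQs hfr htc p q hpq hc heq
    have htI : t ∈ Icc a b := ⟨has.trans hst.le, htb⟩
    -- positions at `t` are those of the free-flight configuration
    have hpos : ∀ k, (freeFlight (Torus.geometry d) (t - s) (Φ.flow s z) k).1 = (Φ.flow t z k).1 :=
      fun k => by rw [heq, collidePair_apply_fst]
    -- the window splits as `(a, s] ∪ {t}`
    have hset : collisionTimes (Torus.geometry d) ε (fun t => Φ.flow t z) ∩ Ioc a t =
        collisionTimes (Torus.geometry d) ε (fun t => Φ.flow t z) ∩ Ioc a s ∪ {t} := by
      refine Set.ext fun σ => ⟨fun h => ?_, ?_⟩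
      · by_cases hσs : σ ≤ s
        · exact Or.inl ⟨h.1, h.2.1, hσs⟩
        · rcases h.2.2.lt_or_eq with hlt | heq'
          · exact absurd h.1 (hfr σ ⟨not_le.1 hσs, hlt⟩)
          · exact Or.inr heq'
      · rintro (⟨hσc, hσa, hσs⟩ | rfl)
        · exact ⟨hσc, hσa, hσs.trans hst.le⟩
        · exact ⟨htc, has.trans_lt hst, le_rfl⟩
    have hdisj : Disjoint (collisionTimes (Torus.geometry d) ε (fun t => Φ.flow t z) ∩ Ioc a s) {t} :=
      Set.disjoint_singleton_right.2 fun h => (not_lt.2 h.2.2) hst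
    rw [hset, finsum_mem_union hdisj (hfin a s) (Set.finite_singleton t), finsum_mem_singleton]
    have hV := hVfree s t has hst.le htb
    have huniq : ∀ e : Fin N × Fin N, e.1 ≠ e.2 →
        ‖(Torus.geometry d).sepVec (Φ.flow t z e.1).1 (Φ.flow t z e.2).1‖ = ε → e = (p, q) ∨ e = (q, p) :=
      fun e he hn => hγ.eq_or_eq_of_mem_contactPairs (mem_contactPairs.2 ⟨hpq, hc⟩)
        (mem_contactPairs.2 ⟨he, mem_contactSet.2 ⟨hγ.mem t, hn⟩⟩)
    by_cases hpS : p ∈ S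
    · -- intra-cluster collision: the pair sum is twice the jump of the virial
      have hqS : q ∈ S := (haut t ⟨htc, has.trans_lt hst, htb⟩ p q hpq hc).1 hpS
      have hcp : Torus.euclidDist (Φ.flow t z p).1 c < 1 / 4 := hchart t htI p hpS
      have hcq : Torus.euclidDist (Φ.flow t z q).1 c < 1 / 4 := hchart t htI q hqS
      -- antisymmetry of the separation vector in the chart
      have hanti : (Torus.geometry d).sepVec (Φ.flow t z q).1 (Φ.flow t z p).1 =
          -(Torus.geometry d).sepVec (Φ.flow t z p).1 (Φ.flow t z q).1 := by
        rw [Torus.geometry_sepVec, Torus.geometry_sepVec, reprSym_sub_eq_sub_of_lt hcq hcp,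
          reprSym_sub_eq_sub_of_lt hcp hcq, neg_sub]
      have hnorm : ‖(Torus.geometry d).sepVec (Φ.flow t z p).1 (Φ.flow t z q).1‖ = ε :=
        (mem_contactSet.1 hc).2
      have hnorm' : ‖(Torus.geometry d).sepVec (Φ.flow t z q).1 (Φ.flow t z p).1‖ = ε := by
        rw [hanti, norm_neg, hnorm]
      rw [sum_sum_ite_eq_two_mul S (Torus.geometry d) (Φ.flow t z) hpq hpS hqS hnorm hnorm' huniq
        (fun i j => ⟪(Torus.geometry d).sepVec (Φ.flow t z i).1 (Φ.flow t z j).1,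
          (Φ.flow t z i).2 - (Φ.flow t z j).2⟫_ℝ)
        (by simp only [hanti, inner_neg_left, ← neg_sub ((Φ.flow t z p).2), inner_neg_right, neg_neg])]
      -- the jump of the virial
      have hjump := clusterVirial_collidePair_of_mem S c (freeFlight (Torus.geometry d) (t - s) (Φ.flow s z))
        hpq hpS hqS (by rw [hpos]; exact hcp) (by rw [hpos]; exact hcq)
      rw [← heq, hpos p, hpos q] at hjump
      rw [hjump]
      linarith
    · -- a collision outside the cluster: nothing changes for `S`
      have hqS : q ∉ S := fun hqS => hpS ((haut t ⟨htc, has.trans_lt hst, htb⟩ p q hpq hc).2 hqS)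
      rw [sum_sum_ite_eq_zero S (Torus.geometry d) (Φ.flow t z) hpS hqS huniq]
      have hjump := clusterVirial_collidePair_of_not_mem S c
        (freeFlight (Torus.geometry d) (t - s) (Φ.flow s z)) hpS hqS
      rw [← heq] at hjump
      rw [hjump]
      linarith

end Virial

end Summit.AtomisticToContinuum.HydrodynamicLimit.Theorems.ContactAngleEquidistributionSketch

end
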